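import Summits.HodgeConjecture.CorCM.IrreducibleOddWeightsMultiClassDomination
import Summits.HodgeConjecture.CorCM.IrreducibleOddWeightsCommutantSigmaPivot
import HarnessLib

/-!
# The multiplicity formula across all isotypic classes, IV: OVER THE COMMUTANTS —
# `dim ⨆_s S(W_s) = Σ_c r_c·dim A_c` (`dim ⨆_{s,j} D_c·b^s_{c,j} = r_c·δ_c`), additive `⟺ ∀ c` the D-spans
# `D_c⟨b^s_c⟩` are independent, dominated `⟺ ∀ c, D_c⟨b′_c⟩ ≤ ⨆_s D_c⟨b^s_c⟩`

COR-CM (cell `pub-hodgecm2`, binder seat `b16` gen 75, count-neutral claim THE MULTIPLICITY FORMULA ACROSS ALL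
ISOTYPIC CLASSES FOR A WHOLE FAMILY, file M4 — abstract `G`-set level; theorems only, no definition, no named fact,
no `sorry`).  NEW as stated, hence under `Summits/`.  HONEST FRAMING: linear algebra of translates of functions on
finite `G`-sets (files M1–M3 and gen 72/74 C4/S3 `…CommutantDensityShadows`, `…CommutantSigmaPivot`); nothing about
Hodge classes is asserted, `HC_CM` is neither used nor asserted.  The CM reading is file M5 `…MultiClassRank`.

SETTING (files M1–M3 + gen 72 C1).  Pairwise non-isomorphic reference irreducibles `A_c ≤ ℚ^{Y_c}` (`c ∈ C`),
`A_c ≠ 0`, each with its COMMUTANT `𝒟_c ≤ End ℚ^{Y_c}` (ANY; a parameter with its characterising hypothesis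
`h𝒟`, gen 72 C1 `exists_commutant`), D-lines `D_c·a = 𝒟_c.map (applyₗ a)`, `δ_c = dim D_c·a₀_c` (`0 ≠ a₀_c ∈ A_c`),
D-spans `D_c⟨b⟩ = ⨆_j D_c·b_j`; slots `s ∈ S` with pivots `Y_s`, class parts `p^s_c = Σ_j ι^s_{c,j}(b^s_{c,j})`, slot
vectors `W_s = Σ_c p^s_c`; one more slot `Y′`, `W′ = Σ_c p′_c`, `p′_c = Σ_k ι′_{c,k}(b′_{c,k})`.

* §1 ONE CLASS (`iSupIndep_span_shadowCoeff_iff_iSupIndep_of_class`): for shadows `w_s = Σ_j ι^s_j(b^s_j)` from ONE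
  reference `A` (commutant `𝒟`), **`(S(w_s))_s` independent `⟺ (D⟨b^s⟩)_s` independent in `A`** (`dim S(w_s)·δ =
  dim D⟨b^s⟩·dim A` slot by slot, `dim(⨆_s S(w_s))·δ = dim(⨆_s D⟨b^s⟩)·dim A` for the family — C4/S3).
* §2 ALL CLASSES: **`(S(W_s))_s` independent `⟺ ∀ c, (D_c⟨b^s_c⟩)_s` independent**
  (`iSupIndep_span_shadowCoeff_iff_forall_iSupIndep_of_classes`); **`S(W′) ≤ ⨆_s S(W_s) ⟺ ∀ c, D_c⟨b′_c⟩ ≤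
  ⨆_s D_c⟨b^s_c⟩`** (`span_shadowCoeff_le_iSup_iff_forall_iSup_le_of_classes`), family against family
  `iSup_span_shadowCoeff_le_iSup_iff_forall_iSup_le_of_classes`; **THE MULTIPLICITY FORMULA
  `exists_rank_finrank_iSup_span_shadowCoeff_eq_sum_of_classes`: there are `r_c ≤ Σ_s |J_{s,c}|` with
  `dim ⨆_{s,j} D_c·b^s_{c,j} = r_c·δ_c` and `dim ⨆_s S(W_s) = Σ_c r_c·dim A_c`** (M2's `Σ_c` of S3's class counts).

## References

* [Lang2002] S. Lang, *Algebra*, 3rd ed., XVII §1 (modules over the commutant), XVII §3 (density).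
* [Serre1977] J.-P. Serre, *Linear Representations of Finite Groups*, GTM 42, §2.6 (canonical decomposition).
* [Gordon1999HodgeAVSurvey] B. B. Gordon, *A survey of the Hodge conjecture for abelian varieties*, §3 Theorem (proof),
  7.5–7.7, 9.4.3.
* [Deligne1982HodgeCycles] P. Deligne, *Hodge cycles on abelian varieties*, LNM 900 (1982), I.5 (p. 53).
-/

set_option autoImplicit false

noncomputable section

open scoped BigOperators Classical

universe u uC uJ uJ' uS uS' v v' v'' vC vY w

namespace Summit.HodgeConjecture.CorCM.IrrOdd

open Literature.NumberTheory.ComplexMultiplication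

variable {G : Type w} [Group G]

/-! ### §1 One class: independence of shadows is independence of D-spans -/

/-- **ONE CLASS: `(S(w_s))_s` INDEPENDENT `⟺ (D⟨b^s⟩)_s` INDEPENDENT.**  `A ≠ 0` stable irreducible with ANY commutant
`𝒟`; shadows `w_s = Σ_j ι^s_j(b^s_j)` on finitely many pivots `Y_s` (equivariant, jointly independent embeddings,
components in `A`).  `dim S(w_s)·δ = dim D⟨b^s⟩·dim A` for each `s` (C4) and `dim(⨆_s S(w_s))·δ = dim(⨆_s D⟨b^s⟩)·dim A`
(S3), so `dim ⨆_s S(w_s) = Σ_s dim S(w_s) ⟺ dim ⨆_s D⟨b^s⟩ = Σ_s dim D⟨b^s⟩`. [cite: Lang2002, XVII §1 and §3]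
[cite: Serre1977, §2.6] [cite: Gordon1999HodgeAVSurvey, §3 Theorem (proof), 7.5–7.7] -/
theorem iSupIndep_span_shadowCoeff_iff_iSupIndep_of_class {Y : Type vY} [MulAction G Y] [Fintype Y]
    {S : Type uS} [Fintype S] {Yf : S → Type v} [∀ s, MulAction G (Yf s)] [∀ s, Fintype (Yf s)]
    {Jf : S → Type uJ} [∀ s, Fintype (Jf s)]
    {A : Submodule ℚ (Y → ℚ)} {𝒟 : Submodule ℚ ((Y → ℚ) →ₗ[ℚ] (Y → ℚ))}
    (h𝒟 : ∀ L : (Y → ℚ) →ₗ[ℚ] (Y → ℚ), L ∈ 𝒟 ↔ (∀ a ∈ A, L a ∈ A) ∧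
      ∀ (k : G) (a : Y → ℚ), a ∈ A → L (fun y => a (k • y)) = fun y => L a (k • y))
    (hAst : ∀ (k : G) (a : Y → ℚ), a ∈ A → (fun y => a (k • y)) ∈ A)
    (hAirr : ∀ W : Submodule ℚ (Y → ℚ), W ≤ A → W ≠ ⊥ →
      (∀ (k : G) (f : Y → ℚ), f ∈ W → (fun y => f (k • y)) ∈ W) → W = A)
    (hA0 : A ≠ ⊥) (ι : ∀ s, Jf s → ((Y → ℚ) →ₗ[ℚ] (Yf s → ℚ)))
    (hιeq : ∀ s (j : Jf s) (k : G) (a : Y → ℚ), a ∈ A → ι s j (fun y => a (k • y)) = fun y => ι s j a (k • y))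
    (hind : ∀ s (f : Jf s → (Y → ℚ)), (∀ j, f j ∈ A) → ∑ j, ι s j (f j) = 0 → ∀ j, f j = 0)
    {b : ∀ s, Jf s → (Y → ℚ)} (hb : ∀ s j, b s j ∈ A) :
    (iSupIndep fun s => Submodule.span ℚ
        (Set.range fun y : Yf s => fun g : G => (∑ j, ι s j (b s j)) (g • y))) ↔
      iSupIndep fun s => ⨆ j, 𝒟.map (LinearMap.applyₗ (b s j)) := by
  obtain ⟨a₀, ha₀, h0⟩ := Submodule.exists_mem_ne_zero_of_ne_bot hA0
  let T : G → (Y → ℚ) →ₗ[ℚ] (Y → ℚ) := fun k => LinearMap.funLeft ℚ ℚ (fun y : Y => k • y)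
  haveI : FiniteDimensional ℚ A := Submodule.finiteDimensional_of_le le_top
  have hA : 0 < Module.finrank ℚ A :=
    Nat.pos_of_ne_zero fun h' => hA0 (Submodule.finrank_eq_zero.1 h')
  haveI : FiniteDimensional ℚ ↥(𝒟.map (LinearMap.applyₗ a₀)) :=
    Submodule.finiteDimensional_of_le (map_applyₗ_le T (A := A) (fun L => h𝒟 L) ha₀)
  have hδ : 0 < Module.finrank ℚ ↥(𝒟.map (LinearMap.applyₗ a₀)) :=
    Nat.pos_of_ne_zero fun h' => map_applyₗ_ne_bot T (A := A) (fun L => h𝒟 L) h0 (Submodule.finrank_eq_zero.1 h')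
  haveI : ∀ s, Module.Finite ℚ ↥(⨆ j, 𝒟.map (LinearMap.applyₗ (b s j))) := fun s =>
    Submodule.finiteDimensional_of_le (iSup_map_applyₗ_le T (A := A) (fun L => h𝒟 L) (hb s))
  haveI : ∀ s, Module.Finite ℚ
      ↥(Submodule.span ℚ (Set.range fun y : Yf s => fun g : G => (∑ j, ι s j (b s j)) (g • y))) := fun s =>
    Module.Finite.span_of_finite ℚ (Set.finite_range _)
  have hone : ∀ s, Module.finrank ℚ ↥(Submodule.span ℚ (Set.range fun y : Yf s => fun g : G =>
      (∑ j, ι s j (b s j)) (g • y))) * Module.finrank ℚ ↥(𝒟.map (LinearMap.applyₗ a₀)) =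
        Module.finrank ℚ ↥(⨆ j, 𝒟.map (LinearMap.applyₗ (b s j))) * Module.finrank ℚ A :=
    fun s => finrank_span_shadowCoeff_sum_mul_eq (Y₀ := Yf s) h𝒟 hAst hAirr (ι s) (hιeq s) (hind s) (hb s) ha₀ h0
  have hfam := finrank_iSup_span_shadowCoeff_mul_eq (Yf := Yf) h𝒟 hAst hAirr ι hιeq hind hb ha₀ h0
  have hsum : (∑ s, Module.finrank ℚ ↥(Submodule.span ℚ (Set.range fun y : Yf s => fun g : G =>
      (∑ j, ι s j (b s j)) (g • y)))) * Module.finrank ℚ ↥(𝒟.map (LinearMap.applyₗ a₀)) =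
        (∑ s, Module.finrank ℚ ↥(⨆ j, 𝒟.map (LinearMap.applyₗ (b s j)))) * Module.finrank ℚ A := by
    rw [Finset.sum_mul, Finset.sum_mul]
    exact Finset.sum_congr rfl fun s _ => hone s
  rw [← finrank_iSup_eq_sum_finrank_iff_iSupIndep, ← finrank_iSup_eq_sum_finrank_iff_iSupIndep]
  set δ := Module.finrank ℚ ↥(𝒟.map (LinearMap.applyₗ a₀)) with hδdef
  set dA := Module.finrank ℚ A with hdA
  constructor
  · intro h
    have hmul : Module.finrank ℚ ↥(⨆ s, ⨆ j, 𝒟.map (LinearMap.applyₗ (b s j))) * dA =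
        (∑ s, Module.finrank ℚ ↥(⨆ j, 𝒟.map (LinearMap.applyₗ (b s j)))) * dA := by
      rw [← hfam, ← hsum, h]
    exact Nat.eq_of_mul_eq_mul_right hA hmul
  · intro h
    have hmul : Module.finrank ℚ ↥(⨆ s, Submodule.span ℚ (Set.range fun y : Yf s => fun g : G =>
        (∑ j, ι s j (b s j)) (g • y))) * δ =
          (∑ s, Module.finrank ℚ ↥(Submodule.span ℚ (Set.range fun y : Yf s => fun g : G =>
            (∑ j, ι s j (b s j)) (g • y)))) * δ := by
      rw [hfam, hsum, h]
    exact Nat.eq_of_mul_eq_mul_right hδ hmul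

/-! ### §2 All classes -/

section Classes

variable {C : Type uC} [Fintype C] {Yc : C → Type vC} [∀ c, MulAction G (Yc c)] [∀ c, Fintype (Yc c)]
  {Ar : ∀ c, Submodule ℚ (Yc c → ℚ)} {𝒟 : ∀ c, Submodule ℚ ((Yc c → ℚ) →ₗ[ℚ] (Yc c → ℚ))}
  {S : Type uS} [Fintype S] {Yf : S → Type v} [∀ s, MulAction G (Yf s)] [∀ s, Fintype (Yf s)]
  {JJ : S → C → Type uJ} [∀ s c, Fintype (JJ s c)]
  {Y₁ : Type v''} [MulAction G Y₁] [Fintype Y₁] {J₁ : C → Type uJ'} [∀ c, Fintype (J₁ c)]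

/-- **ADDITIVITY OVER THE COMMUTANTS: `(S(W_s))_s` independent `⟺ ∀ c`, the D-spans `(D_c⟨b^s_c⟩)_s` are independent
in `A_c`** (file M3 class by class, §1 in each class). [cite: Lang2002, XVII §1 and §3] [cite: Serre1977, §2.6]
[cite: Gordon1999HodgeAVSurvey, §3 Theorem (proof), 7.5–7.7] -/
theorem iSupIndep_span_shadowCoeff_iff_forall_iSupIndep_of_classes
    (h𝒟 : ∀ c (L : (Yc c → ℚ) →ₗ[ℚ] (Yc c → ℚ)), L ∈ 𝒟 c ↔ (∀ a ∈ Ar c, L a ∈ Ar c) ∧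
      ∀ (k : G) (a : Yc c → ℚ), a ∈ Ar c → L (fun y => a (k • y)) = fun y => L a (k • y))
    (hRst : ∀ c (k : G) (a : Yc c → ℚ), a ∈ Ar c → (fun y => a (k • y)) ∈ Ar c)
    (hRirr : ∀ c (W : Submodule ℚ (Yc c → ℚ)), W ≤ Ar c → W ≠ ⊥ →
      (∀ (k : G) (f : Yc c → ℚ), f ∈ W → (fun y => f (k • y)) ∈ W) → W = Ar c)
    (hR0 : ∀ c, Ar c ≠ ⊥)
    (hsep : ∀ c c' (L : (Yc c → ℚ) →ₗ[ℚ] (Yc c' → ℚ)), c ≠ c' → Ar c ≠ ⊥ → (∀ a ∈ Ar c, L a ∈ Ar c') →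
      (∀ a ∈ Ar c, L a = 0 → a = 0) →
      (∀ (k : G) (a : Yc c → ℚ), a ∈ Ar c → L (fun y => a (k • y)) = fun y => L a (k • y)) → False)
    (ι : ∀ s c, JJ s c → ((Yc c → ℚ) →ₗ[ℚ] (Yf s → ℚ)))
    (hιeq : ∀ s c (j : JJ s c) (k : G) (a : Yc c → ℚ), a ∈ Ar c →
      ι s c j (fun y => a (k • y)) = fun y => ι s c j a (k • y))
    (hind : ∀ s c (f : JJ s c → (Yc c → ℚ)), (∀ j, f j ∈ Ar c) → ∑ j, ι s c j (f j) = 0 → ∀ j, f j = 0)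
    {b : ∀ s c, JJ s c → (Yc c → ℚ)} (hb : ∀ s c j, b s c j ∈ Ar c) :
    (iSupIndep fun s => Submodule.span ℚ
        (Set.range fun y : Yf s => fun g : G => (∑ c, ∑ j, ι s c j (b s c j)) (g • y))) ↔
      ∀ c, iSupIndep fun s => ⨆ j, (𝒟 c).map (LinearMap.applyₗ (b s c j)) := by
  rw [iSupIndep_span_shadowCoeff_iff_forall_of_classes hRst hRirr hsep ι hιeq hind hb]
  exact forall_congr' fun c => iSupIndep_span_shadowCoeff_iff_iSupIndep_of_class (h𝒟 c) (hRst c) (hRirr c)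
    (hR0 c) (fun s => ι s c) (fun s => hιeq s c) (fun s => hind s c) (fun s => hb s c)

/-- **DOMINATION OVER THE COMMUTANTS: `S(W′) ≤ ⨆_s S(W_s) ⟺ ∀ c, D_c⟨b′_c⟩ ≤ ⨆_s D_c⟨b^s_c⟩`** — one more slot is
absorbed by the family iff in every class its components are `D_c`-combinations of all the family's class-`c`
components (file M3 class by class, S3 absorption in each class). [cite: Lang2002, XVII §3] [cite: Serre1977, §2.6]
[cite: Gordon1999HodgeAVSurvey, §3 Theorem (proof), 7.5–7.7] [cite: Deligne1982HodgeCycles, I.5 (p. 53)] -/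
theorem span_shadowCoeff_le_iSup_iff_forall_iSup_le_of_classes
    (h𝒟 : ∀ c (L : (Yc c → ℚ) →ₗ[ℚ] (Yc c → ℚ)), L ∈ 𝒟 c ↔ (∀ a ∈ Ar c, L a ∈ Ar c) ∧
      ∀ (k : G) (a : Yc c → ℚ), a ∈ Ar c → L (fun y => a (k • y)) = fun y => L a (k • y))
    (hRst : ∀ c (k : G) (a : Yc c → ℚ), a ∈ Ar c → (fun y => a (k • y)) ∈ Ar c)
    (hRirr : ∀ c (W : Submodule ℚ (Yc c → ℚ)), W ≤ Ar c → W ≠ ⊥ →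
      (∀ (k : G) (f : Yc c → ℚ), f ∈ W → (fun y => f (k • y)) ∈ W) → W = Ar c)
    (hR0 : ∀ c, Ar c ≠ ⊥)
    (hsep : ∀ c c' (L : (Yc c → ℚ) →ₗ[ℚ] (Yc c' → ℚ)), c ≠ c' → Ar c ≠ ⊥ → (∀ a ∈ Ar c, L a ∈ Ar c') →
      (∀ a ∈ Ar c, L a = 0 → a = 0) →
      (∀ (k : G) (a : Yc c → ℚ), a ∈ Ar c → L (fun y => a (k • y)) = fun y => L a (k • y)) → False)
    (ι : ∀ s c, JJ s c → ((Yc c → ℚ) →ₗ[ℚ] (Yf s → ℚ))) (ι₁ : ∀ c, J₁ c → ((Yc c → ℚ) →ₗ[ℚ] (Y₁ → ℚ)))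
    (hιeq : ∀ s c (j : JJ s c) (k : G) (a : Yc c → ℚ), a ∈ Ar c →
      ι s c j (fun y => a (k • y)) = fun y => ι s c j a (k • y))
    (hι₁eq : ∀ c (j : J₁ c) (k : G) (a : Yc c → ℚ), a ∈ Ar c →
      ι₁ c j (fun y => a (k • y)) = fun y => ι₁ c j a (k • y))
    (hind : ∀ s c (f : JJ s c → (Yc c → ℚ)), (∀ j, f j ∈ Ar c) → ∑ j, ι s c j (f j) = 0 → ∀ j, f j = 0)
    (hind₁ : ∀ c (f : J₁ c → (Yc c → ℚ)), (∀ j, f j ∈ Ar c) → ∑ j, ι₁ c j (f j) = 0 → ∀ j, f j = 0)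
    {b : ∀ s c, JJ s c → (Yc c → ℚ)} {b₁ : ∀ c, J₁ c → (Yc c → ℚ)}
    (hb : ∀ s c j, b s c j ∈ Ar c) (hb₁ : ∀ c j, b₁ c j ∈ Ar c) :
    Submodule.span ℚ (Set.range fun y : Y₁ => fun g : G => (∑ c, ∑ j, ι₁ c j (b₁ c j)) (g • y)) ≤
        (⨆ s, Submodule.span ℚ
          (Set.range fun y : Yf s => fun g : G => (∑ c, ∑ j, ι s c j (b s c j)) (g • y))) ↔
      ∀ c, (⨆ j, (𝒟 c).map (LinearMap.applyₗ (b₁ c j))) ≤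
        ⨆ s, ⨆ j, (𝒟 c).map (LinearMap.applyₗ (b s c j)) := by
  rw [span_shadowCoeff_le_iSup_iff_forall_of_classes hRst hRirr hsep ι ι₁ hιeq hι₁eq hind hind₁ hb hb₁]
  exact forall_congr' fun c => span_shadowCoeff_le_iSup_iff_iSup_le (h𝒟 c) (hRst c) (hRirr c) (hR0 c)
    (fun s => ι s c) (ι₁ c) (fun s => hιeq s c) (hι₁eq c) (fun s => hind s c) (hind₁ c) (fun s => hb s c) (hb₁ c)

omit [Fintype Y₁] [MulAction G Y₁] [∀ c, Fintype (J₁ c)] in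
/-- **FAMILY AGAINST FAMILY OVER THE COMMUTANTS: `⨆_t S(W′_t) ≤ ⨆_s S(W_s) ⟺ ∀ c, ⨆_t D_c⟨b′^t_c⟩ ≤ ⨆_s D_c⟨b^s_c⟩`.**
[cite: Lang2002, XVII §3] [cite: Serre1977, §2.6] [cite: Deligne1982HodgeCycles, I.5 (p. 53)] -/
theorem iSup_span_shadowCoeff_le_iSup_iff_forall_iSup_le_of_classes
    (h𝒟 : ∀ c (L : (Yc c → ℚ) →ₗ[ℚ] (Yc c → ℚ)), L ∈ 𝒟 c ↔ (∀ a ∈ Ar c, L a ∈ Ar c) ∧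
      ∀ (k : G) (a : Yc c → ℚ), a ∈ Ar c → L (fun y => a (k • y)) = fun y => L a (k • y))
    (hRst : ∀ c (k : G) (a : Yc c → ℚ), a ∈ Ar c → (fun y => a (k • y)) ∈ Ar c)
    (hRirr : ∀ c (W : Submodule ℚ (Yc c → ℚ)), W ≤ Ar c → W ≠ ⊥ →
      (∀ (k : G) (f : Yc c → ℚ), f ∈ W → (fun y => f (k • y)) ∈ W) → W = Ar c)
    (hR0 : ∀ c, Ar c ≠ ⊥)
    (hsep : ∀ c c' (L : (Yc c → ℚ) →ₗ[ℚ] (Yc c' → ℚ)), c ≠ c' → Ar c ≠ ⊥ → (∀ a ∈ Ar c, L a ∈ Ar c') →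
      (∀ a ∈ Ar c, L a = 0 → a = 0) →
      (∀ (k : G) (a : Yc c → ℚ), a ∈ Ar c → L (fun y => a (k • y)) = fun y => L a (k • y)) → False)
    (ι : ∀ s c, JJ s c → ((Yc c → ℚ) →ₗ[ℚ] (Yf s → ℚ)))
    {S' : Type uS'} [Fintype S'] {Yf' : S' → Type v''} [∀ t, MulAction G (Yf' t)] [∀ t, Fintype (Yf' t)]
    {JJ' : S' → C → Type uJ'} [∀ t c, Fintype (JJ' t c)]
    (ι' : ∀ t c, JJ' t c → ((Yc c → ℚ) →ₗ[ℚ] (Yf' t → ℚ)))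
    (hιeq : ∀ s c (j : JJ s c) (k : G) (a : Yc c → ℚ), a ∈ Ar c →
      ι s c j (fun y => a (k • y)) = fun y => ι s c j a (k • y))
    (hι'eq : ∀ t c (j : JJ' t c) (k : G) (a : Yc c → ℚ), a ∈ Ar c →
      ι' t c j (fun y => a (k • y)) = fun y => ι' t c j a (k • y))
    (hind : ∀ s c (f : JJ s c → (Yc c → ℚ)), (∀ j, f j ∈ Ar c) → ∑ j, ι s c j (f j) = 0 → ∀ j, f j = 0)
    (hind' : ∀ t c (f : JJ' t c → (Yc c → ℚ)), (∀ j, f j ∈ Ar c) → ∑ j, ι' t c j (f j) = 0 → ∀ j, f j = 0)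
    {b : ∀ s c, JJ s c → (Yc c → ℚ)} {b' : ∀ t c, JJ' t c → (Yc c → ℚ)}
    (hb : ∀ s c j, b s c j ∈ Ar c) (hb' : ∀ t c j, b' t c j ∈ Ar c) :
    (⨆ t, Submodule.span ℚ
        (Set.range fun y : Yf' t => fun g : G => (∑ c, ∑ j, ι' t c j (b' t c j)) (g • y))) ≤
        (⨆ s, Submodule.span ℚ
          (Set.range fun y : Yf s => fun g : G => (∑ c, ∑ j, ι s c j (b s c j)) (g • y))) ↔
      ∀ c, (⨆ t, ⨆ j, (𝒟 c).map (LinearMap.applyₗ (b' t c j))) ≤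
        ⨆ s, ⨆ j, (𝒟 c).map (LinearMap.applyₗ (b s c j)) := by
  rw [iSup_le_iff]
  simp only [iSup_le_iff]
  rw [forall_comm]
  refine forall_congr' fun t => ?_
  rw [span_shadowCoeff_le_iSup_iff_forall_iSup_le_of_classes h𝒟 hRst hRirr hR0 hsep ι (ι' t) hιeq (hι'eq t) hind
    (hind' t) hb (hb' t)]
  exact forall_congr' fun c => iSup_le_iff

/-- **THE MULTIPLICITY FORMULA ACROSS ALL ISOTYPIC CLASSES**: there are `r_c ≤ Σ_s |J_{s,c}|` (the `D_c`-RANKS of all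
the class-`c` components) with **`dim ⨆_{s,j} D_c·b^s_{c,j} = r_c·δ_c` and `dim ⨆_s S(W_s) = Σ_c r_c·dim A_c`** — the
coefficient space of a whole family counts, class by class, the `D_c`-rank of its components times `dim A_c`
(file M2's direct sum of S3's class counts). [cite: Lang2002, XVII §1 and §3] [cite: Serre1977, §2.6]
[cite: Gordon1999HodgeAVSurvey, §3 Theorem (proof), 7.5–7.7] -/
theorem exists_rank_finrank_iSup_span_shadowCoeff_eq_sum_of_classes
    (h𝒟 : ∀ c (L : (Yc c → ℚ) →ₗ[ℚ] (Yc c → ℚ)), L ∈ 𝒟 c ↔ (∀ a ∈ Ar c, L a ∈ Ar c) ∧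
      ∀ (k : G) (a : Yc c → ℚ), a ∈ Ar c → L (fun y => a (k • y)) = fun y => L a (k • y))
    (hRst : ∀ c (k : G) (a : Yc c → ℚ), a ∈ Ar c → (fun y => a (k • y)) ∈ Ar c)
    (hRirr : ∀ c (W : Submodule ℚ (Yc c → ℚ)), W ≤ Ar c → W ≠ ⊥ →
      (∀ (k : G) (f : Yc c → ℚ), f ∈ W → (fun y => f (k • y)) ∈ W) → W = Ar c)
    (hsep : ∀ c c' (L : (Yc c → ℚ) →ₗ[ℚ] (Yc c' → ℚ)), c ≠ c' → Ar c ≠ ⊥ → (∀ a ∈ Ar c, L a ∈ Ar c') →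
      (∀ a ∈ Ar c, L a = 0 → a = 0) →
      (∀ (k : G) (a : Yc c → ℚ), a ∈ Ar c → L (fun y => a (k • y)) = fun y => L a (k • y)) → False)
    (ι : ∀ s c, JJ s c → ((Yc c → ℚ) →ₗ[ℚ] (Yf s → ℚ)))
    (hιeq : ∀ s c (j : JJ s c) (k : G) (a : Yc c → ℚ), a ∈ Ar c →
      ι s c j (fun y => a (k • y)) = fun y => ι s c j a (k • y))
    (hind : ∀ s c (f : JJ s c → (Yc c → ℚ)), (∀ j, f j ∈ Ar c) → ∑ j, ι s c j (f j) = 0 → ∀ j, f j = 0)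
    {b : ∀ s c, JJ s c → (Yc c → ℚ)} (hb : ∀ s c j, b s c j ∈ Ar c)
    {a₀ : ∀ c, Yc c → ℚ} (ha₀ : ∀ c, a₀ c ∈ Ar c) (h0 : ∀ c, a₀ c ≠ 0) :
    ∃ r : C → ℕ, (∀ c, r c ≤ ∑ s, Fintype.card (JJ s c)) ∧
      (∀ c, Module.finrank ℚ ↥(⨆ s, ⨆ j, (𝒟 c).map (LinearMap.applyₗ (b s c j))) =
        r c * Module.finrank ℚ ↥((𝒟 c).map (LinearMap.applyₗ (a₀ c)))) ∧
      Module.finrank ℚ ↥(⨆ s, Submodule.span ℚ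
          (Set.range fun y : Yf s => fun g : G => (∑ c, ∑ j, ι s c j (b s c j)) (g • y))) =
        ∑ c, r c * Module.finrank ℚ (Ar c) := by
  choose r hr hD hS using fun c => exists_rank_finrank_iSup_span_shadowCoeff_eq (Yf := Yf) (h𝒟 c) (hRst c)
    (hRirr c) (fun s => ι s c) (fun s => hιeq s c) (fun s => hind s c) (fun s => hb s c) (ha₀ c) (h0 c)
  refine ⟨r, hr, hD, ?_⟩
  rw [finrank_iSup_span_shadowCoeff_eq_sum_of_classes hRst hRirr hsep ι hιeq hind hb]
  exact Finset.sum_congr rfl fun c _ => hS c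

end Classes

end Summit.HodgeConjecture.CorCM.IrrOdd

end
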